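import Literature.MathematicalPhysics.QuantumFieldTheory.Balaban1983to89.B13Lemma3TorusSocket
import Literature.MathematicalPhysics.QuantumFieldTheory.Balaban1983to89.FlowStep

/-!
# `Balaban1983to89.B13NodeTorusFamily` — [Balaban1988RG2Cluster] CMP **116** (1988) 1–22, Lemmas 1–3 pp. 9, 11, 20 along a RUN:
# the B13 leaf triple as a HISTORY-INDEXED FAMILY `∀ k v, v ∈ FlowStep.Box γ₀ k → Lemma1Printed (S k v) c ∧ Lemma2Printed (S k v) c ∧
# Lemma3Printed (S k v) c` over two-scale torus step data `S k v = (Wt k v).toStepData` — ONE constants record `c` and ONE bundle of Lemma 3's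
# numerical restrictions serve every step `k` and every coupling history `v = (g_0, …, g_k) ∈ ]0, γ₀]^{k+1}` (the k-uniformity of the
# paper's «absolute constants», made a kernel statement: the only history-dependent letter of the estimates, the |P|-rate `a = γ₂ε₁²/g_k²`
# of (2.26), is monotone in `g_k ≤ γ₀`)

statement-level bookkeeping over published theorems with citation tags; kernel-checked compositions of tree theorems;
nothing here is a claim about the Yang–Mills mass gap.

CITATION HEADER (lean-in-tree rule).  Source: T. Bałaban, *Renormalization group approach to lattice gauge field theories. II. Cluster
expansions*, Commun. Math. Phys. **116**, 1–22 (1988), doi:10.1007/bf01239022 [Balaban1988RG2Cluster] (cell paper B13 = «[II]»).  p. 9 Lemma 1: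
*"There exist absolute constants C₁, C₂, q, for which |V′_k(Y, 𝐔, 𝐉, B)| ≦ E₀ε₁C₁M^q exp C₂κ₁ exp(−(1 − 2δ)κd_k(Y)). (1.36)"*; p. 17 (2.26):
*"… exp(−½γ₂(ε₁²/g_k²)|P|)·exp O(1)α₅|Z|"*; p. 18: *"Assuming (1/20)γ₂ε₁²/g_k² ≧ (1/20)γ₂ε₁²/γ² ≧ 4κ"* — the one place where the
coupling `g_k` enters Lemma 3's estimates, monotonically, with [I]'s interval constant `γ` (`0 < g_k ≦ γ`, [Balaban1987RG1] Thm 1 p. 259)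
as the worst case; p. 20 Lemma 3: *"Under all the above restrictions on the constants M, κ, κ₁, α₀, α₁, α₄, α₆, γ₂, γ, ε₁, the activity H(Z) …
satisfies the inequality |H(Z)| ≦ C₃ε₁ exp(−(1 − 8δ)½Lκd_{k+1}(Z)). (2.38)"*.  Seat `pub-ymgap-dag-p2` = n10-a (YM-PLAN Track A, HUMAN RULING
D-0062: the KNIT-BY-NAME seat of node N10), generation g4, module 2.  BY NAME and UNCHANGED: `…B13Lemma3TorusSocket` (lit-balaban r10
lineage: `TermDomination`, `Termwise226`, `Lemma3Numerics`, `hRep_of_termwise`, `bound238With_of_hRep`, `termwise226_anti`),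
`…TreeLengthTorusGeometry236Printed` (`ineq236Printed_torus`), `…B13Lemma3Torus` (`TwoTorusStep`, `toStepData`), `…B13`
(`Lemma1Printed`, `Lemma2Printed`, `Lemma3Printed`, `Bound238`, `bound238With_half`), `…FlowStep` (`Box`, `mem_box`, `prefixOf`).

WHY THIS FILE (cell pub-ymgap, typing item TS-3 «b13 per run vs. per (k, history)», dag-lead [ROUTE-N09A-S3-JUNCTION] ∕ dag-n09-a
[S3-JUNCTION-ASK] ∕ dagwriter g81 [TS3-WORD] 2026-08-25): the statement of record types the B13 group of a run as ONE `B13.StepData` (one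
configuration type, one scale); [I]'s Theorem 3 consumes Lemmas 1–3 at EVERY step k of the run and at every admissible coupling history, so
the typing of record for the restatement window is the word (R1): a FAMILY `S13 : (k : ℕ) → (Fin (k + 1) → ℝ) → B13.StepData` with its own box
numeric `γ13` and `b13 := ∀ k v, v ∈ FlowStep.Box γ13 k → Lemma1Printed (S13 k v) c13 ∧ Lemma2Printed (S13 k v) c13 ∧ Lemma3Printed (S13 k v) c13`.
The seat answered (bus l.9750) that the N10 torus chain specialises to every (k, v): this file is that answer AS A THEOREM.  The N10 chain
(`B13NodeTorusTermwise.b13Leaf_twoTorus_termwise ∕ _primitives`, p411918) is quantified over ONE `Wt : TwoTorusStep 4 L N′`, the scale `k`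
(Lemma 1's π_j-tower only), the coupling through Lemma 2's `g ≠ 0` and Lemma 3's |P|-rate `a`, and constants `c` that see neither k nor the
history; the ONLY history-sensitive letter is `a = γ₂ε₁²/g_k²`, in which (2.26) is ANTITONE (`B13Lemma3TorusSocket.termwise226_anti`), so the 25
restrictions `Lemma3Numerics c M₃ ℓ a …` are checked ONCE at the box minimum `a₀ = γ₂ε₁²/γ₀²` (print p. 18: «(1/20)γ₂ε₁²/g_k² ≧ (1/20)γ₂ε₁²/γ²»).

WHAT THIS FILE PROVES (0 `sorry`, 0 `def`, standard axioms).
§1 `last_pos_of_mem_box`, `last_le_of_mem_box`, `rate_min_le_rate` — for `v ∈ FlowStep.Box γ₀ k`: `0 < g_k := v (Fin.last k) ≤ γ₀`, hence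
   `γ₂ε₁²/γ₀² ≤ γ₂ε₁²/g_k²` (`0 ≤ γ₂`); `prefixOf_mem_box` (a run's coupling prefix lies in the box when `0 < g_i ≤ γ₀`, i ≤ k).
§2 **`bound238_family`** — (2.38) FOR EVERY (k, v) IN THE BOX: for a history-indexed family of two-scale torus steps `Wt k v : TwoTorusStep 4 L
   (N′ k v)` with term maps `T₃ k v` satisfying termwise domination and (2.26) per term AT THE NATURAL RATE `γ₂ε₁²/(v (Fin.last k))²`, and ONE
   numerics bundle at `a₀ = γ₂ε₁²/γ₀²` (ℓ = ½L, L ≥ 8, (2.36) by `ineq236Printed_torus`): `∀ k v, v ∈ Box γ₀ k → B13.Bound238 (Wt k v).toStepData c`;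
   `lemma3Printed_family` (the typed Lemma 3 `Restr → (2.38)` for every member).
§3 **`b13Family_of_termwise`** — THE (R1) SHAPE: from Lemma 1 ∧ Lemma 2 per member (supplied per (k, v) by `B13NodeTorusTermwise.lemma12_twoTorus`
   from the located inputs — HERE a hypothesis, this file being the family SOCKET, not a second copy of the 300 located binders) and §2's Lemma-3
   inputs: `∀ k v, v ∈ Box γ₀ k → Lemma1Printed (Wt k v).toStepData c ∧ Lemma2Printed … ∧ Lemma3Printed …`; **`b13Family_stepData`** — the same
   for any family `S : (k : ℕ) → (Fin (k + 1) → ℝ) → B13.StepData` pinned to the torus data on the box (`hS : S k v = (Wt k v).toStepData`), i.e.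
   literally the dagwriter's `b13` family predicate; `b13Family_mono` (a family statement on the box `γ₀` restricts to every smaller box — the
   guard `w.γ ≤ γ13` of the junction); `b13Family_at_prefix` (specialisation at a run's coupling prefix); §4 `update_prefixOf_mem_box`, `b13Family_at_update`, `lemma3_at_update` —
   the (k, g)-reading with the last coupling variable, i.e. the `h3` slot of N09's `B12NodeKnit.hdel_of_lemma3Family` (p412608) by ONE specialisation.

HONEST FRAMING.  Count-neutral typing∕bookkeeping for the TS-3 restatement (RESTATE window 08-30…09-01; the bytes of record are the
dagwriter's ∕ node00-def's, not this file's): NOT a discharge of N10 — the per-member inputs (Lemma 1 ∧ 2 of each `Wt k v`, the term maps with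
termwise domination and (2.26) per term, i.e. the NODE-O∕A primitive kernels with L17a∕L16a uniformly in k — cell GAPS G-B9-10 — and the numbers)
are hypotheses; what the file settles is that NO k- or history-dependence hides in the constants of the typed Lemmas 1–3 on the torus beyond
`g_k ≤ γ₀`.  `g = 0` is excluded by the box (`Set.Ioc 0 γ₀`), as in print (the P^{(k)} terms are `g_k⁻²W(g_kB)`).  Bałaban AS PRINTED with page
locators; one finite T⁴ programme at fixed ε per run — NOT continuum ∕ ℝ⁴ ∕ OS ∕ mass gap ∕ Clay.  No `sorry`, no definition, no new named fact.
-/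

noncomputable section

namespace Literature.MathematicalPhysics.QuantumFieldTheory.Balaban1983to89.B13NodeTorusFamily

open Literature.MathematicalPhysics.QuantumFieldTheory.Balaban1983to89
open Literature.MathematicalPhysics.QuantumFieldTheory.Balaban1983to89.TreeLengthTorus
open Literature.MathematicalPhysics.QuantumFieldTheory.Balaban1983to89.TreeLengthTorusTransfer (tclosureDom)
open Literature.MathematicalPhysics.QuantumFieldTheory.Balaban1983to89.TreeLengthTorusGeometry236Printed (ineq236Printed_torus)
open Literature.MathematicalPhysics.QuantumFieldTheory.Balaban1983to89.B13Lemma3TorusData (TBond)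
open Literature.MathematicalPhysics.QuantumFieldTheory.Balaban1983to89.B13Lemma3Torus (TwoTorusStep)
open Literature.MathematicalPhysics.QuantumFieldTheory.Balaban1983to89.B13Lemma3TorusSocket
  (TermDomination Termwise226 Lemma3Numerics hRep_of_termwise bound238With_of_hRep termwise226_anti)
open Literature.MathematicalPhysics.QuantumFieldTheory.Balaban1983to89.FlowStep (Box mem_box prefixOf)

/-! ## §1. The box `]0, γ₀]^{k+1}` of coupling histories and the |P|-rate of (2.26) -/

/-- In the box, the current coupling `g_k = v (Fin.last k)` is positive. [cite: Balaban1987RG1, Thm 1 p.259 («0 < g_k ≦ γ»); Balaban1988RG2Cluster, p.18 (bookkeeping)] -/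
theorem last_pos_of_mem_box {γ₀ : ℝ} {k : ℕ} {v : Fin (k + 1) → ℝ} (hv : v ∈ Box γ₀ k) : 0 < v (Fin.last k) :=
  ((mem_box.1 hv) (Fin.last k)).1

/-- In the box, the current coupling is at most the interval constant: `g_k ≤ γ₀`. [cite: Balaban1987RG1, Thm 1 p.259; Balaban1988RG2Cluster, p.18 (bookkeeping)] -/
theorem last_le_of_mem_box {γ₀ : ℝ} {k : ℕ} {v : Fin (k + 1) → ℝ} (hv : v ∈ Box γ₀ k) : v (Fin.last k) ≤ γ₀ :=
  ((mem_box.1 hv) (Fin.last k)).2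

/-- **p. 18, the one history-dependent inequality**: *"(1/20)γ₂ε₁²/g_k² ≧ (1/20)γ₂ε₁²/γ²"* — on the box the natural |P|-rate
`a(k, v) = γ₂ε₁²/g_k²` of (2.26) is at least the box minimum `a₀ = γ₂ε₁²/γ₀²` (`0 ≤ γ₂`). [cite: Balaban1988RG2Cluster, p.18 (after (2.32))] -/
theorem rate_min_le_rate {γ₀ γ₂ ε₁ : ℝ} (hγ₂ : 0 ≤ γ₂) {k : ℕ} {v : Fin (k + 1) → ℝ} (hv : v ∈ Box γ₀ k) :
    γ₂ * ε₁ ^ 2 / γ₀ ^ 2 ≤ γ₂ * ε₁ ^ 2 / (v (Fin.last k)) ^ 2 := by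
  have hg : 0 < v (Fin.last k) := last_pos_of_mem_box hv
  have hgγ : v (Fin.last k) ≤ γ₀ := last_le_of_mem_box hv
  have hnum : 0 ≤ γ₂ * ε₁ ^ 2 := mul_nonneg hγ₂ (sq_nonneg _)
  exact div_le_div_of_nonneg_left hnum (pow_pos hg 2) (pow_le_pow_left₀ hg.le hgγ 2)

/-- A run's coupling prefix `(g_0, …, g_k)` lies in the box when `0 < g_i ≤ γ₀` for `i ≤ k` ([I]'s interval hypothesis along the run).
[cite: Balaban1987RG1, Thm 1 p.259 (the interval hypothesis; bookkeeping)] -/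
theorem prefixOf_mem_box {γ₀ : ℝ} {g : ℕ → ℝ} {k : ℕ} (hg : ∀ i, i ≤ k → 0 < g i ∧ g i ≤ γ₀) : prefixOf g k ∈ Box γ₀ k :=
  mem_box.2 fun i => hg i (Nat.le_of_lt_succ i.2)

/-! ## §2. Lemma 3 (2.38) for every member of a history-indexed family of two-scale torus steps -/

section Family

variable {L : ℕ} [NeZero L]
variable {N' : (k : ℕ) → (Fin (k + 1) → ℝ) → ℕ} [∀ k v, NeZero (N' k v)]

open Classical in
/-- **(2.38) ALONG A RUN, FOR EVERY STEP AND EVERY COUPLING HISTORY IN THE BOX.**  For a family of two-scale torus step data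
`Wt k v : TwoTorusStep 4 L (N′ k v)` (𝐃_k = `tsys 4 (L·N′)`, 𝐃_{k+1} = `tsys 4 N′`, N′ free per member) with term maps `T₃ k v` such that, for
every `v ∈ ]0, γ₀]^{k+1}`, the activity is termwise dominated (`hH`, (2.9)/(2.14)) and every term obeys (2.26) AT THE NATURAL RATE
`a(k, v) = γ₂ε₁²/g_k²`, `g_k = v (Fin.last k)` (`h226`), and for ONE bundle of the printed restrictions on the constants at the box-minimal rate
`a₀ = γ₂ε₁²/γ₀²` (`hN`, ℓ = ½L; L ≥ 8 so that (2.36) is the tree's `ineq236Printed_torus`): `|H(Z)| ≤ C₃ε₁e^{−(1−8δ)½Lκd_{k+1}(Z)}` on the space of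
p. 15 for EVERY member.  Route: rate antitonicity (§1 + `termwise226_anti`) → `hRep_of_termwise` → `bound238With_of_hRep` (every resummation ∕
geometric ∕ combinatorial step of pp. 17–20 kernel-checked there). [cite: Balaban1988RG2Cluster, (2.26) p.17, p.18, Lemma 3 (2.38) p.20] -/
theorem bound238_family (c : B13.Consts) (hL8 : 8 ≤ c.L) (hLc : c.L = L) (hγ₂ : 0 ≤ c.γ₂) {γ₀ : ℝ}
    (Wt : (k : ℕ) → (v : Fin (k + 1) → ℝ) → TwoTorusStep 4 L (N' k v)) (M₃ : ℕ) [NeZero M₃]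
    (T₃ : (k : ℕ) → (v : Fin (k + 1) → ℝ) → (Z : TDom 4 (N' k v)) →
      Finset (TDom 4 (L * N' k v)) × Finset (TBond 4 M₃ (L * N' k v)) → (Wt k v).Φ → ℂ)
    {a₂ a₂' a₅ Aabs : ℝ}
    (hH : ∀ k v, v ∈ Box γ₀ k → TermDomination M₃ (Wt k v) (T₃ k v))
    (h226 : ∀ k v, v ∈ Box γ₀ k → Termwise226 c (c.γ₂ * c.ε₁ ^ 2 / (v (Fin.last k)) ^ 2) a₅ (Wt k v) (T₃ k v))
    (hN : Lemma3Numerics c M₃ ((c.L : ℝ) / 2) (c.γ₂ * c.ε₁ ^ 2 / γ₀ ^ 2) a₂ a₂' a₅ Aabs) :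
    ∀ k v, v ∈ Box γ₀ k → B13.Bound238 (Wt k v).toStepData c := by
  intro k v hv
  have hA : 0 ≤ c.α₆ * c.eps2 := mul_nonneg hN.hα₆.le hN.hε₀
  -- (2.26) per term at the box-minimal rate, by antitonicity in the rate
  have h226₀ : Termwise226 c (c.γ₂ * c.ε₁ ^ 2 / γ₀ ^ 2) a₅ (Wt k v) (T₃ k v) :=
    termwise226_anti c hA (rate_min_le_rate hγ₂ hv) (Wt k v) (T₃ k v) (h226 k v hv)
  -- (2.36) at ℓ = ½L on this member's pair of tori
  have h236 : B13.Ineq236With (tsys 4 (L * N' k v)) (tsys 4 (N' k v)) (tclosureDom L (N' k v)) ((c.L : ℝ) / 2) := by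
    rw [hLc]
    exact ineq236Printed_torus (d := 4) L (N' k v) (hLc ▸ hL8)
  exact (B13.bound238With_half (Wt k v).toStepData c).1
    (bound238With_of_hRep c hLc (Wt k v) M₃ hN h236 (hRep_of_termwise c hA (Wt k v) (T₃ k v) (hH k v hv) h226₀))

open Classical in
/-- **Lemma 3 AS TYPED (`Restr → (2.38)`) for every member of the family**, from `bound238_family`. [cite: Balaban1988RG2Cluster, Lemma 3 p.20] -/
theorem lemma3Printed_family (c : B13.Consts) (hL8 : 8 ≤ c.L) (hLc : c.L = L) (hγ₂ : 0 ≤ c.γ₂) {γ₀ : ℝ}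
    (Wt : (k : ℕ) → (v : Fin (k + 1) → ℝ) → TwoTorusStep 4 L (N' k v)) (M₃ : ℕ) [NeZero M₃]
    (T₃ : (k : ℕ) → (v : Fin (k + 1) → ℝ) → (Z : TDom 4 (N' k v)) →
      Finset (TDom 4 (L * N' k v)) × Finset (TBond 4 M₃ (L * N' k v)) → (Wt k v).Φ → ℂ)
    {a₂ a₂' a₅ Aabs : ℝ}
    (hH : ∀ k v, v ∈ Box γ₀ k → TermDomination M₃ (Wt k v) (T₃ k v))
    (h226 : ∀ k v, v ∈ Box γ₀ k → Termwise226 c (c.γ₂ * c.ε₁ ^ 2 / (v (Fin.last k)) ^ 2) a₅ (Wt k v) (T₃ k v))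
    (hN : Lemma3Numerics c M₃ ((c.L : ℝ) / 2) (c.γ₂ * c.ε₁ ^ 2 / γ₀ ^ 2) a₂ a₂' a₅ Aabs) :
    ∀ k v, v ∈ Box γ₀ k → B13.Lemma3Printed (Wt k v).toStepData c :=
  fun k v hv _ => bound238_family c hL8 hLc hγ₂ Wt M₃ T₃ hH h226 hN k v hv

/-! ## §3. The (R1) family shape of the B13 leaf -/

open Classical in
/-- **THE B13 LEAF TRIPLE AS A HISTORY-INDEXED FAMILY (the TS-3 (R1) shape), LEVEL T.**  Lemma 1 ∧ Lemma 2 per member (`h12` — per (k, v) the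
conclusion of `B13NodeTorusTermwise.lemma12_twoTorus (Wt k v) c k …` from the located inputs; Lemma 2's `g ≠ 0` is the box's `0 < g_k`) and
§2's Lemma-3 inputs give `∀ k v, v ∈ ]0, γ₀]^{k+1} → Lemma1Printed ∧ Lemma2Printed ∧ Lemma3Printed` for `(Wt k v).toStepData` at ONE constants
record `c`. [cite: Balaban1988RG2Cluster, Lemma 1 p.9, Lemma 2 p.11, Lemma 3 p.20] -/
theorem b13Family_of_termwise (c : B13.Consts) (hL8 : 8 ≤ c.L) (hLc : c.L = L) (hγ₂ : 0 ≤ c.γ₂) {γ₀ : ℝ}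
    (Wt : (k : ℕ) → (v : Fin (k + 1) → ℝ) → TwoTorusStep 4 L (N' k v)) (M₃ : ℕ) [NeZero M₃]
    (T₃ : (k : ℕ) → (v : Fin (k + 1) → ℝ) → (Z : TDom 4 (N' k v)) →
      Finset (TDom 4 (L * N' k v)) × Finset (TBond 4 M₃ (L * N' k v)) → (Wt k v).Φ → ℂ)
    {a₂ a₂' a₅ Aabs : ℝ}
    (h12 : ∀ k v, v ∈ Box γ₀ k → B13.Lemma1Printed (Wt k v).toStepData c ∧ B13.Lemma2Printed (Wt k v).toStepData c)
    (hH : ∀ k v, v ∈ Box γ₀ k → TermDomination M₃ (Wt k v) (T₃ k v))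
    (h226 : ∀ k v, v ∈ Box γ₀ k → Termwise226 c (c.γ₂ * c.ε₁ ^ 2 / (v (Fin.last k)) ^ 2) a₅ (Wt k v) (T₃ k v))
    (hN : Lemma3Numerics c M₃ ((c.L : ℝ) / 2) (c.γ₂ * c.ε₁ ^ 2 / γ₀ ^ 2) a₂ a₂' a₅ Aabs) :
    ∀ k v, v ∈ Box γ₀ k →
      B13.Lemma1Printed (Wt k v).toStepData c ∧ B13.Lemma2Printed (Wt k v).toStepData c ∧
        B13.Lemma3Printed (Wt k v).toStepData c :=
  fun k v hv => ⟨(h12 k v hv).1, (h12 k v hv).2,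
    lemma3Printed_family c hL8 hLc hγ₂ Wt M₃ T₃ hH h226 hN k v hv⟩

open Classical in
/-- **THE DAGWRITER'S `b13` FAMILY PREDICATE, LITERALLY**: for any history-indexed family of step data
`S : (k : ℕ) → (Fin (k + 1) → ℝ) → B13.StepData` that a pin identifies on the box with the records of the two-scale torus steps
(`hS : S k v = (Wt k v).toStepData`), `∀ k v, v ∈ FlowStep.Box γ₀ k → Lemma1Printed (S k v) c ∧ Lemma2Printed (S k v) c ∧ Lemma3Printed (S k v) c`.
[cite: Balaban1988RG2Cluster, Lemma 1 p.9, Lemma 2 p.11, Lemma 3 p.20] -/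
theorem b13Family_stepData (c : B13.Consts) (hL8 : 8 ≤ c.L) (hLc : c.L = L) (hγ₂ : 0 ≤ c.γ₂) {γ₀ : ℝ}
    (S : (k : ℕ) → (Fin (k + 1) → ℝ) → B13.StepData)
    (Wt : (k : ℕ) → (v : Fin (k + 1) → ℝ) → TwoTorusStep 4 L (N' k v))
    (hS : ∀ k v, v ∈ Box γ₀ k → S k v = (Wt k v).toStepData) (M₃ : ℕ) [NeZero M₃]
    (T₃ : (k : ℕ) → (v : Fin (k + 1) → ℝ) → (Z : TDom 4 (N' k v)) →
      Finset (TDom 4 (L * N' k v)) × Finset (TBond 4 M₃ (L * N' k v)) → (Wt k v).Φ → ℂ)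
    {a₂ a₂' a₅ Aabs : ℝ}
    (h12 : ∀ k v, v ∈ Box γ₀ k → B13.Lemma1Printed (Wt k v).toStepData c ∧ B13.Lemma2Printed (Wt k v).toStepData c)
    (hH : ∀ k v, v ∈ Box γ₀ k → TermDomination M₃ (Wt k v) (T₃ k v))
    (h226 : ∀ k v, v ∈ Box γ₀ k → Termwise226 c (c.γ₂ * c.ε₁ ^ 2 / (v (Fin.last k)) ^ 2) a₅ (Wt k v) (T₃ k v))
    (hN : Lemma3Numerics c M₃ ((c.L : ℝ) / 2) (c.γ₂ * c.ε₁ ^ 2 / γ₀ ^ 2) a₂ a₂' a₅ Aabs) :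
    ∀ k v, v ∈ Box γ₀ k →
      B13.Lemma1Printed (S k v) c ∧ B13.Lemma2Printed (S k v) c ∧ B13.Lemma3Printed (S k v) c := by
  intro k v hv
  rw [hS k v hv]
  exact b13Family_of_termwise c hL8 hLc hγ₂ Wt M₃ T₃ h12 hH h226 hN k v hv

end Family

/-! ## §4. Box monotonicity and the per-run reading (the N09 junction's guards) -/

/-- **A family statement on the box `γ₀` restricts to every smaller box** `γ ≤ γ₀` — the guard «`w.γ ≤ γ13`» under which N09's `hdel`
specialises the B13 family (`FlowStep.box_mono`). [cite: Balaban1987RG1, Thm 1 p.259 (the interval constant; bookkeeping)] -/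
theorem b13Family_mono {γ γ₀ : ℝ} (hγ : γ ≤ γ₀) (S : (k : ℕ) → (Fin (k + 1) → ℝ) → B13.StepData) (c : B13.Consts)
    (h : ∀ k v, v ∈ Box γ₀ k → B13.Lemma1Printed (S k v) c ∧ B13.Lemma2Printed (S k v) c ∧ B13.Lemma3Printed (S k v) c) :
    ∀ k v, v ∈ Box γ k → B13.Lemma1Printed (S k v) c ∧ B13.Lemma2Printed (S k v) c ∧ B13.Lemma3Printed (S k v) c :=
  fun k v hv => h k v (FlowStep.box_mono hγ k hv)

/-- **The per-run reading**: along a run with couplings `0 < g_i ≤ γ` for `i ≤ k` (the interval hypothesis) and `γ ≤ γ₀`, the family statement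
yields Lemmas 1–3 at the step data of the prefix history `(g_0, …, g_k)` — the member [I]'s Theorem 3 consumes at step k.
[cite: Balaban1987RG1, Thm 3 p.264 (consumes Lemmas 1–3 at every step); Balaban1988RG2Cluster, Lemmas 1–3 pp.9, 11, 20] -/
theorem b13Family_at_prefix {γ γ₀ : ℝ} (hγ : γ ≤ γ₀) (S : (k : ℕ) → (Fin (k + 1) → ℝ) → B13.StepData) (c : B13.Consts)
    (h : ∀ k v, v ∈ Box γ₀ k → B13.Lemma1Printed (S k v) c ∧ B13.Lemma2Printed (S k v) c ∧ B13.Lemma3Printed (S k v) c)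
    {g : ℕ → ℝ} {k : ℕ} (hg : ∀ i, i ≤ k → 0 < g i ∧ g i ≤ γ) :
    B13.Lemma1Printed (S k (prefixOf g k)) c ∧ B13.Lemma2Printed (S k (prefixOf g k)) c ∧
      B13.Lemma3Printed (S k (prefixOf g k)) c :=
  b13Family_mono hγ S c h k (prefixOf g k) (prefixOf_mem_box hg)

/-- The updated-prefix form N09 uses (`Function.update (prefixOf g k) (Fin.last k) x` with `x ∈ ]0, γ]`: the last coupling replaced by a
variable one, [I] (3.53) ∕ Thm 3's β-function argument) also lies in the box. [cite: Balaban1987RG1, Thm 3 p.264 (bookkeeping)] -/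
theorem update_prefixOf_mem_box {γ₀ : ℝ} {g : ℕ → ℝ} {k : ℕ} (hg : ∀ i, i ≤ k → 0 < g i ∧ g i ≤ γ₀) {x : ℝ}
    (hx : 0 < x ∧ x ≤ γ₀) : Function.update (prefixOf g k) (Fin.last k) x ∈ Box γ₀ k := by
  refine mem_box.2 fun i => ?_
  by_cases hi : i = Fin.last k
  · subst hi
    simpa using hx
  · rw [Function.update_of_ne hi]
    exact hg i (Nat.le_of_lt_succ i.2)

/-- **The (k, g)-reading N09 consumes** (`B12NodeKnit.hdel_of_lemma3Family`: `∀ g, 0 < g → g ≤ γ → … (S k g)` with the run's earlier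
couplings frozen): from the family statement on the box `γ₀`, a run with `0 < g_i ≤ γ ≤ γ₀` (i ≤ k) and any last coupling `x ∈ ]0, γ]`, Lemmas 1–3
hold at the step data of the updated prefix `(g_0, …, g_{k−1}, x)` — ONE specialisation line, as announced (bus l.9750 ∕ l.9857).
[cite: Balaban1987RG1, Thm 3 p.264 and (3.53) p.280 (the last coupling as the variable); Balaban1988RG2Cluster, Lemmas 1–3 pp.9, 11, 20] -/
theorem b13Family_at_update {γ γ₀ : ℝ} (hγ : γ ≤ γ₀) (S : (k : ℕ) → (Fin (k + 1) → ℝ) → B13.StepData) (c : B13.Consts)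
    (h : ∀ k v, v ∈ Box γ₀ k → B13.Lemma1Printed (S k v) c ∧ B13.Lemma2Printed (S k v) c ∧ B13.Lemma3Printed (S k v) c)
    {g : ℕ → ℝ} {k : ℕ} (hg : ∀ i, i ≤ k → 0 < g i ∧ g i ≤ γ) {x : ℝ} (hx0 : 0 < x) (hx : x ≤ γ) :
    B13.Lemma1Printed (S k (Function.update (prefixOf g k) (Fin.last k) x)) c ∧
      B13.Lemma2Printed (S k (Function.update (prefixOf g k) (Fin.last k) x)) c ∧
        B13.Lemma3Printed (S k (Function.update (prefixOf g k) (Fin.last k) x)) c :=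
  b13Family_mono hγ S c h k _ (update_prefixOf_mem_box hg ⟨hx0, hx⟩)

/-- … and its Lemma-3 component alone, literally the `h3`-slot currency of `B12NodeKnit.hdel_of_lemma3Family`
(`∀ g, 0 < g → g ≤ γ → B13.Lemma3Printed (S′ k g) c` for `S′ k g :=` the family member at the updated prefix).
[cite: Balaban1987RG1, Thm 3 p.264; Balaban1988RG2Cluster, Lemma 3 p.20] -/
theorem lemma3_at_update {γ γ₀ : ℝ} (hγ : γ ≤ γ₀) (S : (k : ℕ) → (Fin (k + 1) → ℝ) → B13.StepData) (c : B13.Consts)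
    (h : ∀ k v, v ∈ Box γ₀ k → B13.Lemma1Printed (S k v) c ∧ B13.Lemma2Printed (S k v) c ∧ B13.Lemma3Printed (S k v) c)
    {g : ℕ → ℝ} {k : ℕ} (hg : ∀ i, i ≤ k → 0 < g i ∧ g i ≤ γ) :
    ∀ x : ℝ, 0 < x → x ≤ γ → B13.Lemma3Printed (S k (Function.update (prefixOf g k) (Fin.last k) x)) c :=
  fun _ hx0 hx => (b13Family_at_update hγ S c h hg hx0 hx).2.2

end Literature.MathematicalPhysics.QuantumFieldTheory.Balaban1983to89.B13NodeTorusFamily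

end
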